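import Summits.Langlands.Langlands.Statement
import Summits.Langlands.Langlands.Theorems.BaseFieldAscentAscentConjugationSolvableAscentHelpers
import Summits.Langlands.Langlands.Theorems.IrreducibilityBySelfDualityReciprocityUpToIrreducibilityCorrespondsConj
import Literature.NumberTheory.Automorphic.TunnellOctahedralGlobal
import Literature.NumberTheory.Automorphic.GaloisActionPlaces
import Literature.NumberTheory.Automorphic.AutomorphicRepsGLSatakeFlathProofs
import Literature.NumberTheory.GaloisRepresentations.FrobeniusStableExtension
import Literature.NumberTheory.GaloisRepresentations.FrobeniusPlaces
import Literature.NumberTheory.GaloisRepresentations.ResidualPairIntegrality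
import Literature.NumberTheory.GaloisRepresentations.InduceRestrictFieldReducible
import Literature.NumberTheory.GaloisRepresentations.CliffordInducedPrimeIndexConj
import HarnessLib

/-!
# Weak (B)-descent along a Galois layer of prime degree, REDUCIBLE-restriction case: two seams
# (crux `AscentConjugationSolvable`, stmt-Langlands-1094; piece `CyclicPrimeDescent`, stmt-Langlands-18645;
# strategist stub `stub_descentWeakGalToAut`; lead c2 `--supports` helpers, R-free, fact-free)

Support file (closes nothing).  In the reducible case of the DOWN-step's direction (B) — `ρ : Γ_K → GL_n(ℚ̄_ℓ)`
irreducible with `ρ|_{Γ_L}` reducible, `L/K` Galois of prime degree — Clifford theory gives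
`Q ρ Q⁻¹ = Ind_{Γ_L}^{Γ_K} s` for an irreducible `s` (landed `exists_conj_eq_reindex_induce_of_not_isIrreducible_…
restrictField_of_prime`, p166527), reciprocity over `L` gives the cuspidal avatar `π_s` of `s`, and Arthur–Clozel's
automorphic induction of `π_s` needs `π_s` NOT `Gal(L/K)`-stable.  This file supplies that non-stability from the
Galois side:

* `frobStable_of_isGaloisStableSatakeAE` — if the Satake data of `P/L` are `Gal(L/K)`-stable a.e.
  (`IsGaloisStableSatakeAE`) and `s` is a.e. Satake–Frobenius compatible with `P`, then `s` has `Gal(L/K)`-stable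
  Frobenius polynomials a.e. (Satake parameters are unique — Flath, discharged in tree; `q_{σ w} = q_w`);
* `not_isGaloisStableSatakeAE_of_conj_eq_induce` — hence, if moreover `s` is irreducible and `Q ρ Q⁻¹ = Ind s` with
  `ρ` irreducible, `P` is NOT `Gal(L/K)`-stable: otherwise `s` extends to `Γ_K` (landed
  `exists_restrictField_eq_of_frobStable`, p156869) and `ρ` would have the characteristic polynomials of
  `Ind(s̃|_{Γ_L})`, which is never irreducible for `[L:K] > 1` (landed
  `not_isIrreducible_of_charpoly_eq_induce_restrictField`, p167123).

References: J. Arthur, L. Clozel, Ann. of Math. Stud. 120 (1989), Ch. 3 Thm. 6.2 and Lemma 6.4; J.-P. Serre,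
*Linear representations of finite groups*, §7.3–7.4; A. H. Clifford, Ann. of Math. 38 (1937), Thm. 1.
-/

noncomputable section

set_option linter.dupNamespace false -- project-wide option; `Summit.Langlands.Langlands` is the mandated namespace

namespace Summit.Langlands.Langlands.Theorems.SmithKummerSeedCyclicPrimeDescent

open scoped MatrixGroups NumberField Classical Matrix Polynomial
open Filter IsDedekindDomain Field Polynomial
open Literature.NumberTheory.Automorphic Literature.NumberTheory.GaloisRepresentations
open Summit.Langlands

variable {K L : Type} [Field K] [NumberField K] [Field L] [NumberField L] [Algebra K L]
  {m : ℕ} {ℓ : ℕ} [Fact ℓ.Prime]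

/-- **Galois-stable Satake data give Galois-stable Frobenius polynomials on a compatible representation.**
If the Satake data of `P` on `GL_m(𝔸_L)` are `Gal(L/K)`-stable almost everywhere and `s : Γ_L → GL_m(ℚ̄_ℓ)` is
a.e. Satake–Frobenius compatible with `P`, then for every `σ ∈ Gal(L/K)`, at almost every `w` the Frobenius
characteristic polynomials of `s` at `w` and `σ • w` coincide. [cite: ArthurClozelAMS120, Ch. 3 (2.4) and Lemma 6.4] -/
theorem frobStable_of_isGaloisStableSatakeAE [IsGalois K L] {hL : isCompact_glFiniteIntegralLevel m L}
    (ι : PadicAlgCl ℓ ≃+* ℂ) (P : AutomorphicRepData (AutomorphyDatum.gl m L hL))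
    (hstab : IsGaloisStableSatakeAE K P) (s : FramedGaloisRep L (PadicAlgCl ℓ) m)
    (h : ∀ᶠ w : HeightOneSpectrum (𝓞 L) in cofinite, SatakeFrobCompatibleAt ι P s w) (σ : L ≃ₐ[K] L) :
    ∀ᶠ w : HeightOneSpectrum (𝓞 L) in cofinite,
      ∃ Q : (PadicAlgCl ℓ)[X], s.HasFrobCharpolyAt w Q ∧ s.HasFrobCharpolyAt (σ • w) Q := by
  have hgood := eventually_forall_under_eq (F := K) (h.and hstab)
  refine (eventually_under (E := L) hgood).mono fun w hw => ?_
  have hall := hw (w.under (𝓞 K)) rfl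
  have hwv : w.asIdeal.under (𝓞 K) = (w.under (𝓞 K)).asIdeal := rfl
  have hσwv : (σ • w).asIdeal.under (𝓞 K) = (w.under (𝓞 K)).asIdeal :=
    congrArg HeightOneSpectrum.asIdeal
      (HeightOneSpectrum.under_algEquiv_smul (F := K) (E := L) (σ := σ) (w := w))
  obtain ⟨⟨β, hβ, -, hc⟩, hst⟩ := hall w hwv
  obtain ⟨⟨β', hβ', -, hc'⟩, -⟩ := hall (σ • w) hσwv
  -- stability moves `β` to `σ • w`; uniqueness of Satake parameters identifies it with `β'`
  obtain rfl : β' = β :=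
    AutomorphicRepData.hasSatakeParamAt_unique_holds P hβ' (hst (σ • w) (hσwv.trans hwv.symm) β hβ)
  refine ⟨_, hc, ?_⟩
  rwa [residueCard_eq_residueCard_pow_inertiaDeg hσwv,
    HeightOneSpectrum.inertiaDeg_algEquiv_smul (F := K) (E := L) (σ := σ) (w := w),
    ← residueCard_eq_residueCard_pow_inertiaDeg hwv] at hc'

/-- **The cuspidal avatar of a Clifford constituent is not Galois-stable.**  Let `L/K` be Galois of prime
degree, `ρ : Γ_K → GL_n(ℚ̄_ℓ)` irreducible with `Q ρ Q⁻¹ = Ind_{Γ_L}^{Γ_K} s` (equality of framed representations up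
to the reindexing `e`, as produced by `exists_conj_eq_reindex_induce_of_not_isIrreducible_restrictField_of_prime`)
for an irreducible `s : Γ_L → GL_m(ℚ̄_ℓ)`, and `P` on `GL_m(𝔸_L)` a.e. Satake–Frobenius compatible with `s`.  Then
the Satake data of `P` are NOT `Gal(L/K)`-stable: else `s` would have Galois-stable Frobenius polynomials
(`frobStable_of_isGaloisStableSatakeAE`), hence extend to some `s̃` on `Γ_K` (`exists_restrictField_eq_of_frobStable`),
and `ρ` would carry the characteristic polynomials of `Ind(s̃|_{Γ_L})`, impossible for an irreducible `ρ`
(`not_isIrreducible_of_charpoly_eq_induce_restrictField`). [cite: ArthurClozelAMS120, Ch. 3 Thm. 6.2 and Lemma 6.4]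
[cite: SerreLinearRepresentations1977, §7.4 Cor.] -/
theorem not_isGaloisStableSatakeAE_of_conj_eq_induce [IsGalois K L] (hp : (Module.finrank K L).Prime)
    {n : ℕ} (ρ : FramedGaloisRep K (PadicAlgCl ℓ) n) (hirr : FramedRep.IsIrreducible ρ)
    (s : FramedGaloisRep L (PadicAlgCl ℓ) m) (hs : FramedRep.IsIrreducible s) (Q : GL (Fin n) (PadicAlgCl ℓ))
    (e : Fin (Module.finrank K L * m) ≃ Fin n)
    (hconj : ∀ x : absoluteGaloisGroup K,
      ((FramedRep.conj Q ρ x : GL (Fin n) (PadicAlgCl ℓ)) : Matrix (Fin n) (Fin n) (PadicAlgCl ℓ)) =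
        Matrix.reindex e e ((s.induce K (rfl : Module.finrank K L = Module.finrank K L) x :
          GL (Fin (Module.finrank K L * m)) (PadicAlgCl ℓ)) :
            Matrix (Fin (Module.finrank K L * m)) (Fin (Module.finrank K L * m)) (PadicAlgCl ℓ)))
    {hL : isCompact_glFiniteIntegralLevel m L} (ι : PadicAlgCl ℓ ≃+* ℂ)
    (P : AutomorphicRepData (AutomorphyDatum.gl m L hL))
    (h : ∀ᶠ w : HeightOneSpectrum (𝓞 L) in cofinite, SatakeFrobCompatibleAt ι P s w) :
    ¬ IsGaloisStableSatakeAE K P := by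
  intro hstab
  haveI : FiniteDimensional K L := Module.Finite.of_restrictScalars_finite ℚ K L
  haveI : IsCyclic (L ≃ₐ[K] L) :=
    BaseFieldAscentAscentConjugationSolvable.isCyclic_algEquiv_of_finrank_prime K L hp
  have hunr : ∀ᶠ w : HeightOneSpectrum (𝓞 L) in cofinite, s.IsUnramifiedAt w :=
    h.mono fun w ⟨_, _, hur, _⟩ => hur
  obtain ⟨t, ht⟩ := FramedGaloisRep.exists_restrictField_eq_of_frobStable s hs hunr
    (frobStable_of_isGaloisStableSatakeAE ι P hstab s h)
  refine not_isIrreducible_of_charpoly_eq_induce_restrictField K L hp.one_lt ρ t (fun x => ?_) hirr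
  rw [ht, ← IrreducibleOffSector.charpoly_conj Q ρ x, FramedRep.charpoly, hconj x, Matrix.charpoly_reindex]
  rfl

/-- **Registered stub `frobStable_of_galoisStableSatake` (crux stmt-Langlands-1094, lead c2)**, closed form of
`frobStable_of_isGaloisStableSatakeAE`. [cite: ArthurClozelAMS120, Ch. 3 (2.4) and Lemma 6.4] -/
theorem frobStable_of_galoisStableSatake : ∀ (K L : Type) [Field K] [NumberField K] [Field L] [NumberField L] [Algebra K L] [IsGalois K L] (m : ℕ) (hL : Literature.NumberTheory.Automorphic.isCompact_glFiniteIntegralLevel m L) (ℓ : ℕ) [Fact ℓ.Prime] (ι : PadicAlgCl ℓ ≃+* ℂ) (P : Literature.NumberTheory.Automorphic.AutomorphicRepData (Literature.NumberTheory.Automorphic.AutomorphyDatum.gl m L hL)), Literature.NumberTheory.Automorphic.IsGaloisStableSatakeAE K P → ∀ (s : Literature.NumberTheory.GaloisRepresentations.FramedGaloisRep L (PadicAlgCl ℓ) m), (∀ᶠ w : IsDedekindDomain.HeightOneSpectrum (NumberField.RingOfIntegers L) in cofinite, SatakeFrobCompatibleAt ι P s w) → ∀ σ : L ≃ₐ[K]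 L, ∀ᶠ w : IsDedekindDomain.HeightOneSpectrum (NumberField.RingOfIntegers L) in cofinite, ∃ Q : Polynomial (PadicAlgCl ℓ), s.HasFrobCharpolyAt w Q ∧ s.HasFrobCharpolyAt (σ • w) Q :=
  fun _ _ _ _ _ _ _ _ _ _ _ _ ι P hstab s h σ => frobStable_of_isGaloisStableSatakeAE ι P hstab s h σ

/-- **Registered stub `not_isGaloisStableSatakeAE_of_conjInduce` (crux stmt-Langlands-1094, lead c2)**, closed form of
`not_isGaloisStableSatakeAE_of_conj_eq_induce`. [cite: ArthurClozelAMS120, Ch. 3 Thm. 6.2 and Lemma 6.4] -/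
theorem not_isGaloisStableSatakeAE_of_conjInduce : ∀ (K L : Type) [Field K] [NumberField K] [Field L] [NumberField L] [Algebra K L] [IsGalois K L], (Module.finrank K L).Prime → ∀ (ℓ : ℕ) [Fact ℓ.Prime] {n m : ℕ} (ρ : Literature.NumberTheory.GaloisRepresentations.FramedGaloisRep K (PadicAlgCl ℓ) n), Literature.NumberTheory.GaloisRepresentations.FramedRep.IsIrreducible ρ → ∀ (s : Literature.NumberTheory.GaloisRepresentations.FramedGaloisRep L (PadicAlgCl ℓ) m), Literature.NumberTheory.GaloisRepresentations.FramedRep.IsIrreducible s → ∀ (Q : GL (Fin n) (PadicAlgCl ℓ)) (e : Fin (Module.finrank K L * m) ≃ Fin n), (∀ x : Field.absoluteGaloisGroup K, ((Literature.NumberTheory.GaloisRepresentations.FramedRep.conj Q ρ x : GL (Fin n) (PadicAlgCl ℓ)) : Matrix (Fin n) (Fin n) (PadicAlgCl ℓ)) = Matrix.reindex e e ((s.induce K (rfl : Module.finrank K L = Module.finrank K L) x : GL (Fin (Module.finrank K L * m)) (PadicAlgCl ℓ)) : Matrix (Fin (Module.finrank K L * m)) (Fin (Module.finrank K L * m)) (PadicAlgCl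 ℓ))) → ∀ (hL : Literature.NumberTheory.Automorphic.isCompact_glFiniteIntegralLevel m L) (ι : PadicAlgCl ℓ ≃+* ℂ) (P : Literature.NumberTheory.Automorphic.AutomorphicRepData (Literature.NumberTheory.Automorphic.AutomorphyDatum.gl m L hL)), (∀ᶠ w : IsDedekindDomain.HeightOneSpectrum (NumberField.RingOfIntegers L) in cofinite, SatakeFrobCompatibleAt ι P s w) → ¬ Literature.NumberTheory.Automorphic.IsGaloisStableSatakeAE K P :=
  fun _ _ _ _ _ _ _ _ hp _ _ _ _ ρ hirr s hs Q e hconj _ ι P h =>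
    not_isGaloisStableSatakeAE_of_conj_eq_induce hp ρ hirr s hs Q e hconj ι P h

end Summit.Langlands.Langlands.Theorems.SmithKummerSeedCyclicPrimeDescent

end
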